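import Summits.ABC.StewartYu.PadicG3ParNBudgetAc
import HarnessLib

/-!
# The `𝔑`-threaded odd-`p` record `PadicG3ParN` — file C: THE FOUR BUDGET INEQUALITIES of p2's
# `ineqPackSat_schedN_one` (`hKfar`, `hKlam`, `hHfar`, `hHlam`), every `m`

Support file (theorems only; no named facts). Cell `abc-stewartyu`, route `YuMatveevShapeRat`, crux r3 `PadicCoreOddRat`
(stmt-ABC-20503); seat p1 (record owner). The hypotheses of p2's pack theorem (HOME/p2/lean/g6/PadicG3SatNPack.lean,
STATUS 2026-08-27T19:25:51Z) in the record's letters, with `F.N` written `P.N` and `S.n` written `n`: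
* `kstep_budget_N` — `L₀N(G+1) + KB ν ≤ (11/4)·Zp + 2^ν·(33/64)·Zp` ⇒ `hKfar_N` (`< 8·2^ν·Zp`) and, with
  `AcondV_le_N`, `hKlam_N` (`< U` whenever `8·2ⁿ·Zp + CondFloorN n ≤ U`, `ν + 1 ≤ n`, `lev ≤ ŜN`);
* `half_budget_N` — `HB ≤ (67/20)·Zp` ⇒ `hHfar_N` (`L₀N(G+1) + 2^{n+1}·HB < 8·2ⁿ·Zp`) and `hHlam_N`.
Ledger (worst corner `g = 1`, all costs in `Zp`): `T₀ʳ·ℓ_T ≤ 17.26·(3.15/64 + 1/512) ≈ 0.88`, `Thr·ℓ_H ≤ (8.5 + 2/(n+1))·(7.45/64 + 1/512)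
≈ 1.09…1.01`, `8·htsV 0 ≤ (n + 1/32)/(n+1) ≤ 1`, `2AV⁺ ≤ 1/3`, `2ℓU ≤ 1/16`, the rest `< 0.2`.

## References
* [Nesterenko2003] Yu. V. Nesterenko, LNM 1819 (2003) — §4.2 (4.29)–(4.35), §4.3 (4.38)–(4.45).
-/

noncomputable section

open Finset Real

namespace Summit.ABC.StewartYu

namespace PadicG3ParN

open PadicG3Par (Cb cM cG two_le_Cb)

variable {n : ℕ} (P : PadicG3ParN n)

/-- the START order letter's per-order cost: `ŜN·log 2 + (23/20)·HV + (HV + W) ≤ W_LV + (43/20)·HV + G/8 − 3n + 13`. [folklore] -/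
theorem letterT_le : (P.SdN : ℝ) * Real.log 2 + 23 / 20 * P.HV + (P.HV + P.W) ≤
    P.WLV + 43 / 20 * P.HV + P.G / 8 - 3 * n + 13 := by
  have h1 := P.SdN_log_le
  have h2 := P.W_add_log_succ_le_WLV
  linarith

/-- the half-step threshold's per-order cost: `ŜN·log 2 + log 2 + (69/20)HV + 2W + (HV+W) ≤ 3·W_LV + (89/20)·HV + G/8 − 3n − 23`
(`W ≤ W_LV − log(LV+1) − 1`, `LV + 1 ≥ 2^{n+25}`). [folklore] -/
theorem letterH_le : (P.SdN : ℝ) * Real.log 2 + Real.log 2 + 69 / 20 * P.HV + 2 * P.W + (P.HV + P.W) ≤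
    3 * P.WLV + 89 / 20 * P.HV + P.G / 8 - 3 * n - 23 := by
  have h1 := P.SdN_log_le
  have h2 := P.W_add_log_succ_le_WLV
  have hl2' : Real.log 2 < 0.6931471808 := Real.log_two_lt_d9
  have hl2 : (0.6931471803 : ℝ) < Real.log 2 := Real.log_two_gt_d9
  -- `log(LV+1) ≥ (n+25) log 2 ≥ 18.7`
  have hLV : (2 : ℝ) ^ (n + 25) ≤ (P.LV : ℝ) + 1 := by
    have h := P.two_pow_le_LV
    have : ((2 ^ (n + 25) : ℕ) : ℝ) ≤ (P.LV : ℝ) := by exact_mod_cast h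
    push_cast at this; linarith
  have hlog : ((n : ℝ) + 25) * Real.log 2 ≤ Real.log ((P.LV : ℝ) + 1) := by
    have := Real.log_le_log (by positivity) hLV
    rw [Real.log_pow] at this; push_cast at this; linarith
  have hn2 : (1 : ℝ) ≤ n := by exact_mod_cast P.hn
  nlinarith

set_option maxHeartbeats 400000 in
/-- **THE k-STEP COST OF THE SATURATED PACK IN THE UNIT `Zp`** (every `m`, `½ ≤ θ₀`, `N_q = K`, `p − 1 ≤ K₀`, `gⁿ ≤ K`,
`log N + log n! + 3 log n ≤ W`): `L₀N(G+1) + KB ν ≤ (11/4)·Zp + 2^ν·(33/64)·Zp`. [cite: Nesterenko2003, §4.2 (4.34); shape only] -/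
theorem kstep_budget_N (hθ : 1 / 2 ≤ P.θ₀) (hNq : P.Nq = P.K) (hK₀ : (P.p : ℝ) - 1 ≤ P.K₀) (hgK : P.g ^ n ≤ (P.K : ℝ))
    (hn2 : 2 ≤ n) (hNCW : Real.log P.N + Real.log (n.factorial : ℝ) + 3 * Real.log n ≤ P.W) (ν : ℕ) :
    P.L0N * (P.G + 1) +
      (4 * Real.log 2 + 2 * (Real.log ((P.L0N : ℝ) + 1) + n * Real.log (n * n.factorial * P.N * P.LV + 1)) +
        2 * (((69 / 4) * (n + 1) * P.LgV + 2 * (n + 1) * ((P.SdN : ℝ) - P.SdG)) * (P.SdN * Real.log 2 + 23 / 20 * P.HV + (P.HV + P.W))) +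
        2 * (P.HV / Real.exp 1) + 2 * (P.L0N * ((P.SdN + n + 6) * Real.log 2)) + 2 * P.htsV 0 + 4 * P.htsV ν + 8 * ∑ j, P.A j) ≤
    (11 / 4) * P.Zp + 2 ^ ν * ((33 / 64) * P.Zp) := by
  -- atoms
  have hL0G := P.L0N_G_le hNq hK₀
  have hU := P.ellU_le hNCW
  have hT0 := P.T0r_le hNq hgK
  have hlT := P.letterT_le
  have hAV := P.AVpN6_le hNq hθ hgK
  have hh0 := P.htsV_le 0
  have hhν := P.htsV_le ν
  have hSA := P.sumA_mul_le
  have huW := P.succ_LgV_WLV_le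
  have huH := P.succ_HV_LgV_le
  have huG := P.succ_LgV_G_le
  have hu := P.succ_LgV_le_Zp
  obtain ⟨hGt, hHt, hLt, _, _⟩ := P.tinyV
  have hZ := P.Zp_facts.1
  have hZ36 := P.Zp_ge
  have hg1 := P.one_le_g
  have hnle := P.n_le
  have hn2r : (2 : ℝ) ≤ n := by exact_mod_cast hn2
  have hl2' : Real.log 2 < 0.6931471808 := Real.log_two_lt_d9
  have he : 2 < Real.exp 1 := by have := Real.exp_one_gt_d9; linarith
  have hHV0 : (0 : ℝ) ≤ P.HV := by positivity
  have hLg0 : (0 : ℝ) ≤ P.LgV := by positivity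
  have hW1 := P.hW
  have hWLV1 := P.WLV_ge_one
  have hG8 := P.eight_le_G
  have hSA0 : 0 ≤ ∑ j, P.A j := Finset.sum_nonneg fun j _ => (P.A_pos j).le
  simp only [pow_zero, one_mul] at hh0
  -- `1/g ≤ 1`
  have hg' : P.Zp / (64 * P.g) ≤ P.Zp / 64 := div_le_div_of_nonneg_left hZ.le (by norm_num) (by nlinarith)
  have hu' : P.Zp / (512 * (n + 1) * P.g ^ 2) ≤ P.Zp / (512 * 3) := by
    apply div_le_div_of_nonneg_left hZ.le (by norm_num); nlinarith
  -- the order product: `T0r · ℓ_T ≤ τ₀ u · (WLV + 43/20 HV + G/8 + 7)` (`13 − 3n ≤ 7`)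
  obtain ⟨u, hudef⟩ : ∃ u : ℝ, u = ((n : ℝ) + 1) * P.LgV := ⟨_, rfl⟩
  have hu0 : 0 ≤ u := by rw [hudef]; positivity
  have hT0u : (69 / 4) * ((n : ℝ) + 1) * P.LgV + 2 * ((n : ℝ) + 1) * ((P.SdN : ℝ) - P.SdG) ≤ (69 / 4 + 1 / 252) * u := by
    rw [hudef]; exact hT0
  have hlT0 : 0 ≤ (P.SdN : ℝ) * Real.log 2 + 23 / 20 * P.HV + (P.HV + P.W) := by positivity
  have hBT : (P.SdN : ℝ) * Real.log 2 + 23 / 20 * P.HV + (P.HV + P.W) ≤ P.WLV + 43 / 20 * P.HV + P.G / 8 + 7 := by linarith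
  have hprod : ((69 / 4) * (n + 1) * P.LgV + 2 * (n + 1) * ((P.SdN : ℝ) - P.SdG)) *
      (P.SdN * Real.log 2 + 23 / 20 * P.HV + (P.HV + P.W)) ≤
      ((69 / 4 + 1 / 252) * u) * (P.WLV + 43 / 20 * P.HV + P.G / 8 + 7) :=
    mul_le_mul hT0u hBT hlT0 (by positivity)
  -- `u·(WLV + 43/20 HV + G/8 + 7) ≤ Zp/64 + (43/20) Zp/64 + Zp/512 + 7 Zp/1536`
  have huWLV : u * P.WLV ≤ P.Zp / 64 := by rw [hudef]; linarith
  have huHV : u * P.HV ≤ P.Zp / 64 := by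
    rw [hudef]; have : ((n : ℝ) + 1) * P.LgV * P.HV = (n + 1) * P.HV * P.LgV := by ring
    linarith
  have huG' : u * P.G ≤ P.Zp / 64 := by rw [hudef]; linarith
  have hu7 : u ≤ P.Zp / 1536 := by rw [hudef]; linarith
  have hsum : ((69 / 4 + 1 / 252) * u) * (P.WLV + 43 / 20 * P.HV + P.G / 8 + 7) ≤ (97 / 100) * P.Zp := by
    have e : ((69 / 4 + 1 / 252) * u) * (P.WLV + 43 / 20 * P.HV + P.G / 8 + 7) =
        (69 / 4 + 1 / 252) * (u * P.WLV + (43 / 20) * (u * P.HV) + (u * P.G) / 8 + 7 * u) := by ring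
    rw [e]; linarith
  -- `2 HV/e ≤ HV`
  have hHVe : P.HV / Real.exp 1 ≤ P.HV / 2 := div_le_div_of_nonneg_left hHV0 (by norm_num) he.le
  -- `8 ΣA ≤ (6n+10) ΣA ≤ Zp/128`
  have h8A : 8 * ∑ j, P.A j ≤ P.Zp / 128 := by
    have h0 : 0 ≤ (6 * (n : ℝ) + 2) * ∑ j, P.A j := by positivity
    linarith [hSA]
  -- constants: `4 log 2 + 2n + G + 12 ≤ Zp/2^28`
  have hconst : 4 * Real.log 2 + 2 * (n : ℝ) + P.G + 12 ≤ P.Zp / 2 ^ 28 := by linarith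
  linarith [hprod, hsum, hL0G, hU, hAV, hh0, hhν, h8A, hHVe, hconst, hHt]

/-- **`hKfar`**: `L₀N(G+1) + KB ν < 8·2^ν·Zp` (every `m`). [cite: Nesterenko2003, §4.2 (4.34)–(4.35); shape only] -/
theorem hKfar_N (hθ : 1 / 2 ≤ P.θ₀) (hNq : P.Nq = P.K) (hK₀ : (P.p : ℝ) - 1 ≤ P.K₀) (hgK : P.g ^ n ≤ (P.K : ℝ))
    (hn2 : 2 ≤ n) (hNCW : Real.log P.N + Real.log (n.factorial : ℝ) + 3 * Real.log n ≤ P.W) (ν : ℕ) :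
    P.L0N * (P.G + 1) +
      (4 * Real.log 2 + 2 * (Real.log ((P.L0N : ℝ) + 1) + n * Real.log (n * n.factorial * P.N * P.LV + 1)) +
        2 * (((69 / 4) * (n + 1) * P.LgV + 2 * (n + 1) * ((P.SdN : ℝ) - P.SdG)) * (P.SdN * Real.log 2 + 23 / 20 * P.HV + (P.HV + P.W))) +
        2 * (P.HV / Real.exp 1) + 2 * (P.L0N * ((P.SdN + n + 6) * Real.log 2)) + 2 * P.htsV 0 + 4 * P.htsV ν + 8 * ∑ j, P.A j) <
    8 * 2 ^ ν * P.Zp := by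
  have h := P.kstep_budget_N hθ hNq hK₀ hgK hn2 hNCW ν
  have hZ := P.Zp_facts.1
  have h2 : (1 : ℝ) ≤ 2 ^ ν := one_le_pow₀ (by norm_num)
  nlinarith

/-- **`hKlam`**: `L₀N(G+1) + AcondV lev ν + KB ν < U` for `lev ≤ ŜN`, `ν + 1 ≤ n`, whenever `8·2ⁿ·Zp + CondFloorN n ≤ U`
(every `m`). [cite: Nesterenko2003, §4.2 (4.30)–(4.31); shape only] -/
theorem hKlam_N (hθ : 1 / 2 ≤ P.θ₀) (hNq : P.Nq = P.K) (hK₀ : (P.p : ℝ) - 1 ≤ P.K₀) (hgK : P.g ^ n ≤ (P.K : ℝ))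
    (hn2 : 2 ≤ n) (hNCW : Real.log P.N + Real.log (n.factorial : ℝ) + 3 * Real.log n ≤ P.W)
    {U : ℝ} (hU : 8 * 2 ^ n * P.Zp + P.CondFloorN n ≤ U) {lev ν : ℕ} (hlev : lev ≤ P.SdN) (hν : ν + 1 ≤ n) :
    P.L0N * (P.G + 1) + P.AcondV lev ν +
      (4 * Real.log 2 + 2 * (Real.log ((P.L0N : ℝ) + 1) + n * Real.log (n * n.factorial * P.N * P.LV + 1)) +
        2 * (((69 / 4) * (n + 1) * P.LgV + 2 * (n + 1) * ((P.SdN : ℝ) - P.SdG)) * (P.SdN * Real.log 2 + 23 / 20 * P.HV + (P.HV + P.W))) +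
        2 * (P.HV / Real.exp 1) + 2 * (P.L0N * ((P.SdN + n + 6) * Real.log 2)) + 2 * P.htsV 0 + 4 * P.htsV ν + 8 * ∑ j, P.A j) < U := by
  have h := P.kstep_budget_N hθ hNq hK₀ hgK hn2 hNCW ν
  have hA := P.AcondV_le_N hθ hNq hgK (s := lev) (ν := ν) hlev (by omega)
  have hCF := P.CondFloorN_mono' (show ν ≤ n by omega)
  have hZ := P.Zp_facts.1
  have hZ36 := P.Zp_ge
  have h2νn : (2 : ℝ) * 2 ^ ν ≤ 2 ^ n := by
    rw [← pow_succ']; exact pow_le_pow_right₀ (by norm_num) hν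
  have h4 : (4 : ℝ) ≤ 2 ^ n := by
    calc (4 : ℝ) = 2 ^ 2 := by norm_num
      _ ≤ 2 ^ n := pow_le_pow_right₀ (by norm_num) hn2
  have h2ν0 : (0 : ℝ) ≤ 2 ^ ν := by positivity
  nlinarith [mul_le_mul_of_nonneg_right h2νn hZ.le, mul_le_mul_of_nonneg_right h4 hZ.le]

set_option maxHeartbeats 400000 in
/-- **THE HALF-STEP PER-DEGREE COST OF THE SATURATED PACK IN THE UNIT `Zp`** (every `m`; same hypotheses):
`HB ≤ (7/2)·Zp`. [cite: Nesterenko2003, §4.3 (4.44)–(4.45); shape only] -/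
theorem half_budget_N (hθ : 1 / 2 ≤ P.θ₀) (hNq : P.Nq = P.K) (hgK : P.g ^ n ≤ (P.K : ℝ))
    (hn2 : 2 ≤ n) (hNCW : Real.log P.N + Real.log (n.factorial : ℝ) + 3 * Real.log n ≤ P.W) :
    6 * Real.log 2 + 2 * (Real.log ((P.L0N : ℝ) + 1) + n * Real.log (n * n.factorial * P.N * P.LV + 1)) +
        ((69 / 4) * (n + 1) * P.LgV + 2 * (n + 1) * ((P.SdN : ℝ) - P.SdG)) * (P.SdN * Real.log 2 + 23 / 20 * P.HV + (P.HV + P.W)) +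
        2 * (P.HV / Real.exp 1) + 2 * (P.L0N * ((P.SdN + n + 6) * Real.log 2)) +
        8 * P.htsV 0 + (2 * P.LgV + (n + 1) * (8 * P.LgV + 2 * P.SdN)) *
          (P.SdN * Real.log 2 + Real.log 2 + 69 / 20 * P.HV + 2 * P.W + (P.HV + P.W)) +
        (6 * n + 10) * ∑ j, P.A j ≤ (7 / 2) * P.Zp := by
  -- atoms
  have hU := P.ellU_le hNCW
  have hT0 := P.T0r_le hNq hgK
  have hTh := P.Thr_le hNq hgK
  have hlT := P.letterT_le
  have hlH := P.letterH_le
  have hAV := P.AVpN6_le hNq hθ hgK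
  have hh0 := P.htsV_le 0
  have hSA := P.sumA_mul_le
  have huW := P.succ_LgV_WLV_le
  have huH := P.succ_HV_LgV_le
  have huG := P.succ_LgV_G_le
  have hu := P.succ_LgV_le_Zp
  obtain ⟨hGt, hHt, hLt, _, _⟩ := P.tinyV
  have hZ := P.Zp_facts.1
  have hZ36 := P.Zp_ge
  have hg1 := P.one_le_g
  have hnle := P.n_le
  have hn2r : (2 : ℝ) ≤ n := by exact_mod_cast hn2
  have hl2' : Real.log 2 < 0.6931471808 := Real.log_two_lt_d9
  have hl20 : 0 < Real.log 2 := Real.log_pos (by norm_num)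
  have he : 2 < Real.exp 1 := by have := Real.exp_one_gt_d9; linarith
  have hHV0 : (0 : ℝ) ≤ P.HV := by positivity
  have hLg0 : (0 : ℝ) ≤ P.LgV := by positivity
  have hW1 := P.hW
  have hWLV1 := P.WLV_ge_one
  have hG8 := P.eight_le_G
  have hSd0 : (0 : ℝ) ≤ P.SdN := Nat.cast_nonneg _
  simp only [pow_zero, one_mul] at hh0
  have hg' : P.Zp / (64 * P.g) ≤ P.Zp / 64 := div_le_div_of_nonneg_left hZ.le (by norm_num) (by nlinarith)
  have hu' : P.Zp / (512 * (n + 1) * P.g ^ 2) ≤ P.Zp / (512 * 3) := by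
    apply div_le_div_of_nonneg_left hZ.le (by norm_num); nlinarith
  obtain ⟨u, hudef⟩ : ∃ u : ℝ, u = ((n : ℝ) + 1) * P.LgV := ⟨_, rfl⟩
  have hu0 : 0 ≤ u := by rw [hudef]; positivity
  have huWLV : u * P.WLV ≤ P.Zp / 64 := by rw [hudef]; linarith
  have huHV : u * P.HV ≤ P.Zp / 64 := by
    rw [hudef]; have : ((n : ℝ) + 1) * P.LgV * P.HV = (n + 1) * P.HV * P.LgV := by ring
    linarith
  have huG' : u * P.G ≤ P.Zp / 64 := by rw [hudef]; linarith
  have hu7 : u ≤ P.Zp / 1536 := by rw [hudef]; linarith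
  have hT0u : (69 / 4) * ((n : ℝ) + 1) * P.LgV + 2 * ((n : ℝ) + 1) * ((P.SdN : ℝ) - P.SdG) ≤ (69 / 4 + 1 / 252) * u := by
    rw [hudef]; exact hT0
  have hThu : 2 * (P.LgV : ℝ) + ((n : ℝ) + 1) * (8 * P.LgV + 2 * P.SdN) ≤ (2143 / 252) * u + 2 * P.LgV := by
    rw [hudef]; exact hTh
  -- the START order product `T0r · ℓ_T ≤ 0.97·Zp`
  have hlT0 : 0 ≤ (P.SdN : ℝ) * Real.log 2 + 23 / 20 * P.HV + (P.HV + P.W) := by positivity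
  have hBT : (P.SdN : ℝ) * Real.log 2 + 23 / 20 * P.HV + (P.HV + P.W) ≤ P.WLV + 43 / 20 * P.HV + P.G / 8 + 7 := by linarith
  have hprodT : ((69 / 4) * (n + 1) * P.LgV + 2 * (n + 1) * ((P.SdN : ℝ) - P.SdG)) *
      (P.SdN * Real.log 2 + 23 / 20 * P.HV + (P.HV + P.W)) ≤
      ((69 / 4 + 1 / 252) * u) * (P.WLV + 43 / 20 * P.HV + P.G / 8 + 7) :=
    mul_le_mul hT0u hBT hlT0 (by positivity)
  have hsumT : ((69 / 4 + 1 / 252) * u) * (P.WLV + 43 / 20 * P.HV + P.G / 8 + 7) ≤ (97 / 100) * P.Zp := by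
    have e : ((69 / 4 + 1 / 252) * u) * (P.WLV + 43 / 20 * P.HV + P.G / 8 + 7) =
        (69 / 4 + 1 / 252) * (u * P.WLV + (43 / 20) * (u * P.HV) + (u * P.G) / 8 + 7 * u) := by ring
    rw [e]; linarith
  -- the threshold product `Thr · ℓ_H ≤ 1.09·Zp`
  have hlH0 : 0 ≤ (P.SdN : ℝ) * Real.log 2 + Real.log 2 + 69 / 20 * P.HV + 2 * P.W + (P.HV + P.W) := by positivity
  have hBH : (P.SdN : ℝ) * Real.log 2 + Real.log 2 + 69 / 20 * P.HV + 2 * P.W + (P.HV + P.W) ≤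
      3 * P.WLV + 89 / 20 * P.HV + P.G / 8 := by linarith
  have hBH0 : 0 ≤ 3 * P.WLV + 89 / 20 * P.HV + P.G / 8 := by positivity
  have hprodH : (2 * (P.LgV : ℝ) + (n + 1) * (8 * P.LgV + 2 * P.SdN)) *
      (P.SdN * Real.log 2 + Real.log 2 + 69 / 20 * P.HV + 2 * P.W + (P.HV + P.W)) ≤
      ((2143 / 252) * u + 2 * P.LgV) * (3 * P.WLV + 89 / 20 * P.HV + P.G / 8) :=
    mul_le_mul hThu hBH hlH0 (by positivity)
  have huB : u * (3 * P.WLV + 89 / 20 * P.HV + P.G / 8) ≤ (3 / 64 + 89 / 1280 + 1 / 512) * P.Zp := by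
    have e : u * (3 * P.WLV + 89 / 20 * P.HV + P.G / 8) = 3 * (u * P.WLV) + (89 / 20) * (u * P.HV) + (u * P.G) / 8 := by ring
    rw [e]; linarith
  have hLB : 3 * ((P.LgV : ℝ) * (3 * P.WLV + 89 / 20 * P.HV + P.G / 8)) ≤ u * (3 * P.WLV + 89 / 20 * P.HV + P.G / 8) := by
    have h0 : 0 ≤ (P.LgV : ℝ) * (3 * P.WLV + 89 / 20 * P.HV + P.G / 8) := mul_nonneg hLg0 hBH0
    calc 3 * ((P.LgV : ℝ) * (3 * P.WLV + 89 / 20 * P.HV + P.G / 8))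
        ≤ ((n : ℝ) + 1) * ((P.LgV : ℝ) * (3 * P.WLV + 89 / 20 * P.HV + P.G / 8)) :=
          mul_le_mul_of_nonneg_right (by linarith) h0
      _ = u * (3 * P.WLV + 89 / 20 * P.HV + P.G / 8) := by rw [hudef]; ring
  have hsumH : ((2143 / 252) * u + 2 * P.LgV) * (3 * P.WLV + 89 / 20 * P.HV + P.G / 8) ≤ (109 / 100) * P.Zp := by
    have e : ((2143 / 252) * u + 2 * P.LgV) * (3 * P.WLV + 89 / 20 * P.HV + P.G / 8) =
        (2143 / 252) * (u * (3 * P.WLV + 89 / 20 * P.HV + P.G / 8)) + 2 * (P.LgV * (3 * P.WLV + 89 / 20 * P.HV + P.G / 8)) := by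
      ring
    rw [e]; linarith [huB, hLB, hZ]
  -- `2 HV/e ≤ HV`
  have hHVe : P.HV / Real.exp 1 ≤ P.HV / 2 := div_le_div_of_nonneg_left hHV0 (by norm_num) he.le
  have hSA0 : 0 ≤ ∑ j, P.A j := Finset.sum_nonneg fun j _ => (P.A_pos j).le
  -- constants: `6 log 2 + 2 + 2n + 6 ≤ Zp/2^28`
  have hconst : 6 * Real.log 2 + 2 * (n : ℝ) + P.G + 12 ≤ P.Zp / 2 ^ 28 := by linarith
  linarith [hprodT, hsumT, hprodH, hsumH, hU, hAV, hh0, hSA, hHVe, hconst, hHt]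

/-- **`hHfar`**: `L₀N(G+1) + 2^{n+1}·HB < 8·2ⁿ·Zp` (every `m`). [cite: Nesterenko2003, §4.3 (4.44)–(4.45); shape only] -/
theorem hHfar_N (hθ : 1 / 2 ≤ P.θ₀) (hNq : P.Nq = P.K) (hK₀ : (P.p : ℝ) - 1 ≤ P.K₀) (hgK : P.g ^ n ≤ (P.K : ℝ))
    (hn2 : 2 ≤ n) (hNCW : Real.log P.N + Real.log (n.factorial : ℝ) + 3 * Real.log n ≤ P.W) :
    P.L0N * (P.G + 1) + 2 ^ (n + 1) *
      (6 * Real.log 2 + 2 * (Real.log ((P.L0N : ℝ) + 1) + n * Real.log (n * n.factorial * P.N * P.LV + 1)) +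
        ((69 / 4) * (n + 1) * P.LgV + 2 * (n + 1) * ((P.SdN : ℝ) - P.SdG)) * (P.SdN * Real.log 2 + 23 / 20 * P.HV + (P.HV + P.W)) +
        2 * (P.HV / Real.exp 1) + 2 * (P.L0N * ((P.SdN + n + 6) * Real.log 2)) +
        8 * P.htsV 0 + (2 * P.LgV + (n + 1) * (8 * P.LgV + 2 * P.SdN)) * (P.SdN * Real.log 2 + Real.log 2 + 69 / 20 * P.HV + 2 * P.W + (P.HV + P.W)) +
        (6 * n + 10) * ∑ j, P.A j) < 8 * 2 ^ n * P.Zp := by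
  have h := P.half_budget_N hθ hNq hgK hn2 hNCW
  have hL0G := P.L0N_G_le hNq hK₀
  obtain ⟨hGt, _, _, _, _⟩ := P.tinyV
  have hZ := P.Zp_facts.1
  have hZ36 := P.Zp_ge
  have h4 : (4 : ℝ) ≤ 2 ^ n := by
    calc (4 : ℝ) = 2 ^ 2 := by norm_num
      _ ≤ 2 ^ n := pow_le_pow_right₀ (by norm_num) hn2
  have h2n0 : (0 : ℝ) ≤ 2 ^ (n + 1) := by positivity
  have e : (2 : ℝ) ^ (n + 1) = 2 * 2 ^ n := by rw [pow_succ]; ring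
  have hmul := mul_le_mul_of_nonneg_left h h2n0
  rw [e] at hmul
  nlinarith [mul_le_mul_of_nonneg_right h4 hZ.le]

/-- **`hHlam`**: `L₀N(G+1) + AcondV lev n + 2^{n+1}·HB < U` for `lev < ŜN`, whenever `8·2ⁿ·Zp + CondFloorN n ≤ U` (every `m`).
[cite: Nesterenko2003, §4.3 (4.44)–(4.45); shape only] -/
theorem hHlam_N (hθ : 1 / 2 ≤ P.θ₀) (hNq : P.Nq = P.K) (hK₀ : (P.p : ℝ) - 1 ≤ P.K₀) (hgK : P.g ^ n ≤ (P.K : ℝ))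
    (hn2 : 2 ≤ n) (hNCW : Real.log P.N + Real.log (n.factorial : ℝ) + 3 * Real.log n ≤ P.W)
    {U : ℝ} (hU : 8 * 2 ^ n * P.Zp + P.CondFloorN n ≤ U) {lev : ℕ} (hlev : lev < P.SdN) :
    P.L0N * (P.G + 1) + P.AcondV lev n + 2 ^ (n + 1) *
      (6 * Real.log 2 + 2 * (Real.log ((P.L0N : ℝ) + 1) + n * Real.log (n * n.factorial * P.N * P.LV + 1)) +
        ((69 / 4) * (n + 1) * P.LgV + 2 * (n + 1) * ((P.SdN : ℝ) - P.SdG)) * (P.SdN * Real.log 2 + 23 / 20 * P.HV + (P.HV + P.W)) +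
        2 * (P.HV / Real.exp 1) + 2 * (P.L0N * ((P.SdN + n + 6) * Real.log 2)) +
        8 * P.htsV 0 + (2 * P.LgV + (n + 1) * (8 * P.LgV + 2 * P.SdN)) * (P.SdN * Real.log 2 + Real.log 2 + 69 / 20 * P.HV + 2 * P.W + (P.HV + P.W)) +
        (6 * n + 10) * ∑ j, P.A j) < U := by
  have h := P.half_budget_N hθ hNq hgK hn2 hNCW
  have hL0G := P.L0N_G_le hNq hK₀
  have hA := P.AcondV_le_N hθ hNq hgK hlev.le le_rfl
  obtain ⟨hGt, _, _, _, _⟩ := P.tinyV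
  have hZ := P.Zp_facts.1
  have hZ36 := P.Zp_ge
  have h4 : (4 : ℝ) ≤ 2 ^ n := by
    calc (4 : ℝ) = 2 ^ 2 := by norm_num
      _ ≤ 2 ^ n := pow_le_pow_right₀ (by norm_num) hn2
  have h2n0 : (0 : ℝ) ≤ 2 ^ (n + 1) := by positivity
  have e : (2 : ℝ) ^ (n + 1) = 2 * 2 ^ n := by rw [pow_succ]; ring
  have hmul := mul_le_mul_of_nonneg_left h h2n0
  rw [e] at hmul
  nlinarith [mul_le_mul_of_nonneg_right h4 hZ.le]

end PadicG3ParN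

end Summit.ABC.StewartYu
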